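import Mathlib.Algebra.BigOperators.Group.Finset.Basic
import Mathlib.Algebra.Order.BigOperators.Group.Finset
import Mathlib.Data.Fintype.BigOperators
import Mathlib.Tactic
import HarnessLib
import Summits.Ventures.HSemireg.FlatTriangleFreeFourCycles
import Summits.Ventures.HSemireg.FlatFourCoordinateBoxes

/-!
# Venture HSemireg — kernel leg of THEOREM L⁺ and COROLLARY H (W5 seat w5-n6-2 gen 17): the box count for triangle-free four-coordinate designs with arbitrary level-uniform margins

Bookkeeping of the computation cell `pub-hsemireg`, group W5 (note `widen/W5/FLATTF-w5n62g17.md` §0,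
§3, §9; scripts `widen/W5/n6code2/v20/flattf/`). Setting: four level types `α β γ δ` (coordinates
`A B C D`), the six torus graphs as neighbourhood maps `nXY` with transposes, and LEVEL-UNIFORM
MARGINS `μX : X → ℕ` — the level `x` of `X` has exactly `μX x` neighbours in each of the three graphs
at `X` (N7-FEASIBILITY §3.6 (a), LEMMA U); `m = Σ_x μX x` tori per pair. TRIANGLE-FREE on the four
triples. `B_XY = Σ_{tori (x,y)} μX x · μY y` (N7F §3.8 (a)); `N₁, N₂, N₃` the transversal 4-cycles of
the three cyclic orders, spelled as in `FlatTriangleFreeFourCycles.lean`.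

* `box_bound_margins` — LEMMA 1 + LEMMA 2 of the note for one torus with general margins:
  `e(S₂,K₁) + e(S₁,K₂) + m ≥ μ(S₁) + μ(S₂) + μ(K₁) + μ(K₂)` for disjoint `S₁, S₂ ⊆ Y`, `K₁, K₂ ⊆ W`
  with empty diagonal blocks in a `Y – W` graph with degrees `μY, μW`, `Σ_w μW w = m`;
* `triangleFree_box_inequality` — **THEOREM L⁺**: `2 ΣB ≤ 2 ΣN(C₄) + 3 m²`;
* `B_le`, `heavy_margin_bound` — **COROLLARY H**: if every margin is `≤ h`, `p = Σ_x (μX x)²` is the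
  same on the four coordinates, `ΣC ≤ 4 h p` is granted for the cubes, and the `|S| = 4` class equation
  holds in the integer form `m ΣN = m (2ΣB + ΣC − 2m²) − 9 p²` (triangle-free sector: `m s = −3p`,
  N7F §3.6 (b) ∕ §3.9 (b)), then `m³ + 18 p² ≤ 20 h m p`, hence `18 m ≤ 100 h²`.

HONEST FRAMING: finite combinatorics and integer arithmetic only. The identification of the hypotheses
with the cell's «fully-R′ K-secant coordinate skeleta» and of the integer equation with
`c₄ = m(s² − m)` lives in the notes, not here. Nothing in this file says that HC, HC_CM or HC_AV holds;
no door ∕ tier ∕ report sentence of the cell is a consequence of this file alone.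
-/

namespace Summit.Ventures.HSemireg

namespace TriangleFreeBoxMargins

open Finset
open FlatTriangleFreeFourCycles (sum_card_inter_comm)
open FlatFourCoordinateBoxes (sum_inter_comm)

section DoubleCounting
variable {X Y : Type*} [DecidableEq X] [DecidableEq Y]

/-- Weighted double counting: `Σ_{x ∈ S} Σ_{y ∈ adj x ∩ T} g y = Σ_{y ∈ T} #(adj' y ∩ S) · g y`. -/
theorem sum_sum_inter_comm (S : Finset X) (T : Finset Y) (adj : X → Finset Y) (adj' : Y → Finset X)
    (h : ∀ x y, y ∈ adj x ↔ x ∈ adj' y) (g : Y → ℕ) :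
    ∑ x ∈ S, ∑ y ∈ adj x ∩ T, g y = ∑ y ∈ T, (adj' y ∩ S).card * g y := by
  have h1 : ∀ x, ∑ y ∈ adj x ∩ T, g y = ∑ y ∈ T, if x ∈ adj' y then g y else 0 := by
    intro x
    rw [Finset.inter_comm, ← Finset.filter_mem_eq_inter, Finset.filter_congr (fun y _ => h x y),
      Finset.sum_filter]
  have h2 : ∀ y, (adj' y ∩ S).card * g y = ∑ x ∈ S, if x ∈ adj' y then g y else 0 := by
    intro y
    rw [← Finset.sum_filter, Finset.filter_mem_eq_inter, Finset.inter_comm, Finset.sum_const,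
      smul_eq_mul]
  simp_rw [h1, h2]
  exact Finset.sum_comm

end DoubleCounting

section Box
variable {Y W : Type*} [Fintype W] [DecidableEq Y] [DecidableEq W]

/-- **Box count with margins** (LEMMA 1 + LEMMA 2 of the note, one torus, triangle-free). In a bipartite
graph `Y – W` in which the level `y` has `μY y` neighbours and the level `w` has `μW w` neighbours,
`Σ_w μW w = m`, let `S₁, S₂ ⊆ Y` and `K₁, K₂ ⊆ W` be disjoint pairs with no edge from `S₁` to `K₁` nor from
`S₂` to `K₂`. Then `e(S₂, K₁) + e(S₁, K₂) + m ≥ μY(S₁) + μY(S₂) + μW(K₁) + μW(K₂)`. -/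
theorem box_bound_margins (m : ℕ) (μY : Y → ℕ) (μW : W → ℕ)
    (nYW : Y → Finset W) (nWY : W → Finset Y) (hc : ∀ y w, w ∈ nYW y ↔ y ∈ nWY w)
    (hY : ∀ y, (nYW y).card = μY y) (hWd : ∀ w, (nWY w).card = μW w) (hm : ∑ w, μW w = m)
    (S₁ S₂ : Finset Y) (K₁ K₂ : Finset W) (hS : Disjoint S₁ S₂) (hK : Disjoint K₁ K₂)
    (hd₁ : ∀ y ∈ S₁, Disjoint (nYW y) K₁) (hd₂ : ∀ y ∈ S₂, Disjoint (nYW y) K₂) :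
    (∑ y ∈ S₁, μY y) + (∑ y ∈ S₂, μY y) + (∑ w ∈ K₁, μW w) + (∑ w ∈ K₂, μW w)
      ≤ (∑ y ∈ S₂, (nYW y ∩ K₁).card) + (∑ y ∈ S₁, (nYW y ∩ K₂).card) + m := by
  classical
  set R : Finset W := univ \ (K₁ ∪ K₂) with hR
  have part : ∀ X : Finset W, X.card = (X ∩ K₁).card + (X ∩ K₂).card + (X ∩ R).card := by
    intro X
    have h1 : X ∩ R = X \ (K₁ ∪ K₂) := by
      ext w; simp only [hR, mem_inter, mem_sdiff, mem_univ, true_and]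
    have h2 : X ∩ (K₁ ∪ K₂) = (X ∩ K₁) ∪ (X ∩ K₂) := Finset.inter_union_distrib_left _ _ _
    have h3 : Disjoint (X ∩ K₁) (X ∩ K₂) := hK.mono inter_subset_right inter_subset_right
    have h4 : (X ∩ (K₁ ∪ K₂)).card + (X \ (K₁ ∪ K₂)).card = X.card :=
      Finset.card_inter_add_card_sdiff X (K₁ ∪ K₂)
    rw [h2, Finset.card_union_of_disjoint h3] at h4
    rw [h1]; omega
  have rowS₁ : ∀ y ∈ S₁, (nYW y ∩ K₂).card + (nYW y ∩ R).card = μY y := by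
    intro y hy
    have hp := part (nYW y)
    rw [hY y, Finset.disjoint_iff_inter_eq_empty.mp (hd₁ y hy), Finset.card_empty] at hp; omega
  have rowS₂ : ∀ y ∈ S₂, (nYW y ∩ K₁).card + (nYW y ∩ R).card = μY y := by
    intro y hy
    have hp := part (nYW y)
    rw [hY y, Finset.disjoint_iff_inter_eq_empty.mp (hd₂ y hy), Finset.card_empty] at hp; omega
  have sumS₁ : (∑ y ∈ S₁, (nYW y ∩ K₂).card) + (∑ y ∈ S₁, (nYW y ∩ R).card) = ∑ y ∈ S₁, μY y := by
    rw [← Finset.sum_add_distrib]; exact Finset.sum_congr rfl (fun y hy => rowS₁ y hy)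
  have sumS₂ : (∑ y ∈ S₂, (nYW y ∩ K₁).card) + (∑ y ∈ S₂, (nYW y ∩ R).card) = ∑ y ∈ S₂, μY y := by
    rw [← Finset.sum_add_distrib]; exact Finset.sum_congr rfl (fun y hy => rowS₂ y hy)
  -- the edges leaving the box land in the columns of `R`
  have restle : (∑ y ∈ S₁, (nYW y ∩ R).card) + (∑ y ∈ S₂, (nYW y ∩ R).card) ≤ ∑ w ∈ R, μW w := by
    rw [← Finset.sum_union hS]
    calc ∑ y ∈ S₁ ∪ S₂, (nYW y ∩ R).card
        ≤ ∑ y ∈ (S₁ ∪ S₂) ∪ (R.biUnion nWY), (nYW y ∩ R).card :=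
          Finset.sum_le_sum_of_subset (Finset.subset_union_left)
      _ = ∑ w ∈ R, (nWY w ∩ ((S₁ ∪ S₂) ∪ (R.biUnion nWY))).card := sum_card_inter_comm _ _ nYW nWY hc
      _ = ∑ w ∈ R, μW w := by
          refine Finset.sum_congr rfl (fun w hw => ?_)
          have hsub : nWY w ⊆ (S₁ ∪ S₂) ∪ (R.biUnion nWY) :=
            fun y hy => Finset.mem_union_right _ (Finset.mem_biUnion.mpr ⟨w, hw, hy⟩)
          rw [Finset.inter_eq_left.mpr hsub, hWd w]
  -- the margins of `W` split as `K₁ ⊔ K₂ ⊔ R`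
  have split : (∑ w ∈ K₁, μW w) + (∑ w ∈ K₂, μW w) + (∑ w ∈ R, μW w) = m := by
    have hKR : Disjoint (K₁ ∪ K₂) R := by rw [hR]; exact Finset.disjoint_sdiff
    have huniv : (K₁ ∪ K₂) ∪ R = univ := by
      rw [hR]; exact Finset.union_sdiff_of_subset (Finset.subset_univ _)
    rw [← Finset.sum_union hK, ← Finset.sum_union hKR, huniv, hm]
  omega

end Box

section Design
variable {α β γ δ : Type*} [Fintype α] [Fintype β] [Fintype γ] [Fintype δ]
  [DecidableEq α] [DecidableEq β] [DecidableEq γ] [DecidableEq δ]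

/-- Sums over the tori of one pair can be taken from either end (weighted by a function of the far end). -/
theorem edge_sum_comm (nAB : α → Finset β) (nBA : β → Finset α) (cAB : ∀ a b, b ∈ nAB a ↔ a ∈ nBA b)
    (g : β → ℕ) : ∑ a, ∑ b ∈ nAB a, g b = ∑ b, (nBA b).card * g b := by
  have := sum_sum_inter_comm (univ : Finset α) (univ : Finset β) nAB nBA cAB g
  simpa [Finset.inter_univ] using this

/-- `B_XY = B_YX`: the margin-weighted torus count of a pair does not depend on the end it is summed from. -/
theorem B_symm {X Y : Type*} [Fintype X] [Fintype Y] [DecidableEq X] [DecidableEq Y]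
    (μX : X → ℕ) (μY : Y → ℕ) (nXY : X → Finset Y) (nYX : Y → Finset X)
    (c : ∀ x y, y ∈ nXY x ↔ x ∈ nYX y) :
    ∑ x, μX x * ∑ y ∈ nXY x, μY y = ∑ y, μY y * ∑ x ∈ nYX y, μX x := by
  simp_rw [Finset.mul_sum]
  have := sum_inter_comm (univ : Finset X) (univ : Finset Y) nXY nYX c (fun x y => μX x * μY y)
  simp only [Finset.univ_inter] at this
  rw [this]
  exact Finset.sum_congr rfl (fun y _ => Finset.sum_congr rfl (fun x _ => by ring))

/-- **THEOREM L⁺** (FLATTF-w5n62g17 §0, §3). For a triangle-free four-coordinate design with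
level-uniform margins `μA, μB, μC, μD` (`m` tori per pair): `2 ΣB ≤ 2 ΣN(C₄) + 3 m²`, where
`B_XY = Σ_x μX x · Σ_{y ∈ nXY x} μY y` and `N₁, N₂, N₃` are the transversal 4-cycle counts of the three
cyclic orders. -/
theorem triangleFree_box_inequality (m : ℕ) (μA : α → ℕ) (μB : β → ℕ) (μC : γ → ℕ) (μD : δ → ℕ)
    (mA : ∑ a, μA a = m) (mC : ∑ c, μC c = m) (mD : ∑ e, μD e = m)
    (nAB : α → Finset β) (nBA : β → Finset α) (nAC : α → Finset γ) (nCA : γ → Finset α)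
    (nAD : α → Finset δ) (nDA : δ → Finset α) (nBC : β → Finset γ) (nCB : γ → Finset β)
    (nBD : β → Finset δ) (nDB : δ → Finset β) (nCD : γ → Finset δ) (nDC : δ → Finset γ)
    (cAB : ∀ a b, b ∈ nAB a ↔ a ∈ nBA b) (cAC : ∀ a c, c ∈ nAC a ↔ a ∈ nCA c)
    (cAD : ∀ a e, e ∈ nAD a ↔ a ∈ nDA e) (cBC : ∀ b c, c ∈ nBC b ↔ b ∈ nCB c)
    (cBD : ∀ b e, e ∈ nBD b ↔ b ∈ nDB e) (cCD : ∀ c e, e ∈ nCD c ↔ c ∈ nDC e)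
    (rAB : ∀ a, (nAB a).card = μA a) (rBA : ∀ b, (nBA b).card = μB b)
    (rAC : ∀ a, (nAC a).card = μA a) (rCA : ∀ c, (nCA c).card = μC c)
    (rAD : ∀ a, (nAD a).card = μA a) (rDA : ∀ e, (nDA e).card = μD e)
    (rBC : ∀ b, (nBC b).card = μB b) (rCB : ∀ c, (nCB c).card = μC c)
    (rBD : ∀ b, (nBD b).card = μB b) (rDB : ∀ e, (nDB e).card = μD e)
    (rCD : ∀ c, (nCD c).card = μC c) (rDC : ∀ e, (nDC e).card = μD e)
    (tABC : ∀ a b c, b ∈ nAB a → c ∈ nBC b → c ∉ nAC a)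
    (tABD : ∀ a b e, b ∈ nAB a → e ∈ nBD b → e ∉ nAD a)
    (tACD : ∀ a c e, c ∈ nAC a → e ∈ nCD c → e ∉ nAD a)
    (tBCD : ∀ b c e, c ∈ nBC b → e ∈ nCD c → e ∉ nBD b) :
    2 * ((∑ a, μA a * ∑ b ∈ nAB a, μB b) + (∑ a, μA a * ∑ c ∈ nAC a, μC c)
         + (∑ a, μA a * ∑ e ∈ nAD a, μD e) + (∑ b, μB b * ∑ c ∈ nBC b, μC c)
         + (∑ b, μB b * ∑ e ∈ nBD b, μD e) + (∑ c, μC c * ∑ e ∈ nCD c, μD e))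
    ≤ 2 * ((∑ a, ∑ b ∈ nAB a, ∑ e ∈ nAD a, (nBC b ∩ nDC e).card)
         + (∑ a, ∑ b ∈ nAB a, ∑ c ∈ nAC a, (nBD b ∩ nCD c).card)
         + (∑ a, ∑ c ∈ nAC a, ∑ e ∈ nAD a, (nCB c ∩ nDB e).card)) + 3 * m ^ 2 := by
  classical
  -- matching {AB, CD}: boxes in C × D over the AB-tori
  have key₁ : ∀ a, ∀ b ∈ nAB a,
      (∑ c ∈ nAC a, μC c) + (∑ c ∈ nBC b, μC c) + (∑ e ∈ nAD a, μD e) + (∑ e ∈ nBD b, μD e)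
        ≤ (∑ e ∈ nAD a, (nBC b ∩ nDC e).card) + (∑ c ∈ nAC a, (nBD b ∩ nCD c).card) + m := by
    intro a b hb
    have hS : Disjoint (nAC a) (nBC b) := Finset.disjoint_left.mpr (fun c hca hcb => tABC a b c hb hcb hca)
    have hK : Disjoint (nAD a) (nBD b) := Finset.disjoint_left.mpr (fun e hea heb => tABD a b e hb heb hea)
    have hd₁ : ∀ c ∈ nAC a, Disjoint (nCD c) (nAD a) := fun c hc =>
      Finset.disjoint_left.mpr (fun e hec hea => tACD a c e hc hec hea)
    have hd₂ : ∀ c ∈ nBC b, Disjoint (nCD c) (nBD b) := fun c hc =>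
      Finset.disjoint_left.mpr (fun e hec heb => tBCD b c e hc hec heb)
    have hbox := box_bound_margins m μC μD nCD nDC cCD rCD rDC mD (nAC a) (nBC b) (nAD a) (nBD b)
      hS hK hd₁ hd₂
    have e1 : ∑ c ∈ nBC b, (nCD c ∩ nAD a).card = ∑ e ∈ nAD a, (nBC b ∩ nDC e).card := by
      rw [sum_card_inter_comm (nBC b) (nAD a) nCD nDC cCD]
      exact Finset.sum_congr rfl (fun e _ => by rw [Finset.inter_comm])
    have e2 : ∑ c ∈ nAC a, (nCD c ∩ nBD b).card = ∑ c ∈ nAC a, (nBD b ∩ nCD c).card :=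
      Finset.sum_congr rfl (fun c _ => by rw [Finset.inter_comm])
    rw [e1, e2] at hbox; exact hbox
  have m₁ : (∑ a, μA a * ∑ c ∈ nAC a, μC c) + (∑ b, μB b * ∑ c ∈ nBC b, μC c)
      + (∑ a, μA a * ∑ e ∈ nAD a, μD e) + (∑ b, μB b * ∑ e ∈ nBD b, μD e)
      ≤ (∑ a, ∑ b ∈ nAB a, ∑ e ∈ nAD a, (nBC b ∩ nDC e).card)
        + (∑ a, ∑ b ∈ nAB a, ∑ c ∈ nAC a, (nBD b ∩ nCD c).card) + m * m := by
    have hsum := Finset.sum_le_sum (s := (univ : Finset α))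
      (fun a _ => Finset.sum_le_sum (fun b hb => key₁ a b hb))
    have lhs : ∑ a ∈ (univ : Finset α), ∑ b ∈ nAB a,
        ((∑ c ∈ nAC a, μC c) + (∑ c ∈ nBC b, μC c) + (∑ e ∈ nAD a, μD e) + (∑ e ∈ nBD b, μD e))
        = (∑ a, μA a * ∑ c ∈ nAC a, μC c) + (∑ b, μB b * ∑ c ∈ nBC b, μC c)
          + (∑ a, μA a * ∑ e ∈ nAD a, μD e) + (∑ b, μB b * ∑ e ∈ nBD b, μD e) := by
      simp only [Finset.sum_add_distrib, Finset.sum_const, smul_eq_mul, rAB]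
      rw [edge_sum_comm nAB nBA cAB (fun b => ∑ c ∈ nBC b, μC c),
        edge_sum_comm nAB nBA cAB (fun b => ∑ e ∈ nBD b, μD e)]
      simp only [rBA]
    have rhs : ∑ a ∈ (univ : Finset α), ∑ b ∈ nAB a,
        ((∑ e ∈ nAD a, (nBC b ∩ nDC e).card) + (∑ c ∈ nAC a, (nBD b ∩ nCD c).card) + m)
        = (∑ a, ∑ b ∈ nAB a, ∑ e ∈ nAD a, (nBC b ∩ nDC e).card)
          + (∑ a, ∑ b ∈ nAB a, ∑ c ∈ nAC a, (nBD b ∩ nCD c).card) + m * m := by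
      simp only [Finset.sum_add_distrib, Finset.sum_const, smul_eq_mul, rAB]
      rw [← Finset.sum_mul, mA]
    rw [lhs, rhs] at hsum; exact hsum
  -- matching {AC, BD}: boxes in B × D over the AC-tori
  have key₂ : ∀ a, ∀ c ∈ nAC a,
      (∑ b ∈ nAB a, μB b) + (∑ b ∈ nCB c, μB b) + (∑ e ∈ nAD a, μD e) + (∑ e ∈ nCD c, μD e)
        ≤ (∑ e ∈ nAD a, (nCB c ∩ nDB e).card) + (∑ b ∈ nAB a, (nBD b ∩ nCD c).card) + m := by
    intro a c hc
    have hS : Disjoint (nAB a) (nCB c) :=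
      Finset.disjoint_left.mpr (fun b hba hbc => tABC a b c hba ((cBC b c).mpr hbc) hc)
    have hK : Disjoint (nAD a) (nCD c) := Finset.disjoint_left.mpr (fun e hea hec => tACD a c e hc hec hea)
    have hd₁ : ∀ b ∈ nAB a, Disjoint (nBD b) (nAD a) := fun b hb =>
      Finset.disjoint_left.mpr (fun e heb hea => tABD a b e hb heb hea)
    have hd₂ : ∀ b ∈ nCB c, Disjoint (nBD b) (nCD c) := fun b hb =>
      Finset.disjoint_left.mpr (fun e heb hec => tBCD b c e ((cBC b c).mpr hb) hec heb)
    have hbox := box_bound_margins m μB μD nBD nDB cBD rBD rDB mD (nAB a) (nCB c) (nAD a) (nCD c)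
      hS hK hd₁ hd₂
    have e1 : ∑ b ∈ nCB c, (nBD b ∩ nAD a).card = ∑ e ∈ nAD a, (nCB c ∩ nDB e).card := by
      rw [sum_card_inter_comm (nCB c) (nAD a) nBD nDB cBD]
      exact Finset.sum_congr rfl (fun e _ => by rw [Finset.inter_comm])
    rw [e1] at hbox; exact hbox
  -- matching {AC, BD}: boxes in B × D over the AC-tori
  have m₂ : (∑ a, μA a * ∑ b ∈ nAB a, μB b) + (∑ b, μB b * ∑ c ∈ nBC b, μC c)
      + (∑ a, μA a * ∑ e ∈ nAD a, μD e) + (∑ c, μC c * ∑ e ∈ nCD c, μD e)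
      ≤ (∑ a, ∑ c ∈ nAC a, ∑ e ∈ nAD a, (nCB c ∩ nDB e).card)
        + (∑ a, ∑ b ∈ nAB a, ∑ c ∈ nAC a, (nBD b ∩ nCD c).card) + m * m := by
    have hsum := Finset.sum_le_sum (s := (univ : Finset α))
      (fun a _ => Finset.sum_le_sum (fun c hc => key₂ a c hc))
    have lhs : ∑ a ∈ (univ : Finset α), ∑ c ∈ nAC a,
        ((∑ b ∈ nAB a, μB b) + (∑ b ∈ nCB c, μB b) + (∑ e ∈ nAD a, μD e) + (∑ e ∈ nCD c, μD e))
        = (∑ a, μA a * ∑ b ∈ nAB a, μB b) + (∑ b, μB b * ∑ c ∈ nBC b, μC c)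
          + (∑ a, μA a * ∑ e ∈ nAD a, μD e) + (∑ c, μC c * ∑ e ∈ nCD c, μD e) := by
      simp only [Finset.sum_add_distrib, Finset.sum_const, smul_eq_mul, rAC]
      rw [edge_sum_comm nAC nCA cAC (fun c => ∑ b ∈ nCB c, μB b),
        edge_sum_comm nAC nCA cAC (fun c => ∑ e ∈ nCD c, μD e)]
      simp only [rCA]
      rw [B_symm μC μB nCB nBC (fun c b => (cBC b c).symm)]
    have rhs : ∑ a ∈ (univ : Finset α), ∑ c ∈ nAC a,
        ((∑ e ∈ nAD a, (nCB c ∩ nDB e).card) + (∑ b ∈ nAB a, (nBD b ∩ nCD c).card) + m)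
        = (∑ a, ∑ c ∈ nAC a, ∑ e ∈ nAD a, (nCB c ∩ nDB e).card)
          + (∑ a, ∑ b ∈ nAB a, ∑ c ∈ nAC a, (nBD b ∩ nCD c).card) + m * m := by
      have hswap : ∀ a : α, ∑ c ∈ nAC a, ∑ b ∈ nAB a, (nBD b ∩ nCD c).card
          = ∑ b ∈ nAB a, ∑ c ∈ nAC a, (nBD b ∩ nCD c).card := fun a => Finset.sum_comm
      simp only [Finset.sum_add_distrib, Finset.sum_const, smul_eq_mul, rAC, hswap]
      rw [← Finset.sum_mul, mA]
    rw [lhs, rhs] at hsum; exact hsum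
  -- matching {AD, BC}: boxes in B × C over the AD-tori
  have key₃ : ∀ a, ∀ e ∈ nAD a,
      (∑ b ∈ nAB a, μB b) + (∑ b ∈ nDB e, μB b) + (∑ c ∈ nAC a, μC c) + (∑ c ∈ nDC e, μC c)
        ≤ (∑ c ∈ nAC a, (nCB c ∩ nDB e).card) + (∑ b ∈ nAB a, (nBC b ∩ nDC e).card) + m := by
    intro a e he
    have hS : Disjoint (nAB a) (nDB e) :=
      Finset.disjoint_left.mpr (fun b hba hbe => tABD a b e hba ((cBD b e).mpr hbe) he)
    have hK : Disjoint (nAC a) (nDC e) :=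
      Finset.disjoint_left.mpr (fun c hca hce => tACD a c e hca ((cCD c e).mpr hce) he)
    have hd₁ : ∀ b ∈ nAB a, Disjoint (nBC b) (nAC a) := fun b hb =>
      Finset.disjoint_left.mpr (fun c hcb hca => tABC a b c hb hcb hca)
    have hd₂ : ∀ b ∈ nDB e, Disjoint (nBC b) (nDC e) := fun b hb =>
      Finset.disjoint_left.mpr (fun c hcb hce => tBCD b c e hcb ((cCD c e).mpr hce) ((cBD b e).mpr hb))
    have hbox := box_bound_margins m μB μC nBC nCB cBC rBC rCB mC (nAB a) (nDB e) (nAC a) (nDC e)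
      hS hK hd₁ hd₂
    have e1 : ∑ b ∈ nDB e, (nBC b ∩ nAC a).card = ∑ c ∈ nAC a, (nCB c ∩ nDB e).card := by
      rw [sum_card_inter_comm (nDB e) (nAC a) nBC nCB cBC]
    rw [e1] at hbox; exact hbox
  have m₃ : (∑ a, μA a * ∑ b ∈ nAB a, μB b) + (∑ b, μB b * ∑ e ∈ nBD b, μD e)
      + (∑ a, μA a * ∑ c ∈ nAC a, μC c) + (∑ c, μC c * ∑ e ∈ nCD c, μD e)
      ≤ (∑ a, ∑ c ∈ nAC a, ∑ e ∈ nAD a, (nCB c ∩ nDB e).card)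
        + (∑ a, ∑ b ∈ nAB a, ∑ e ∈ nAD a, (nBC b ∩ nDC e).card) + m * m := by
    have hsum := Finset.sum_le_sum (s := (univ : Finset α))
      (fun a _ => Finset.sum_le_sum (fun e he => key₃ a e he))
    have lhs : ∑ a ∈ (univ : Finset α), ∑ e ∈ nAD a,
        ((∑ b ∈ nAB a, μB b) + (∑ b ∈ nDB e, μB b) + (∑ c ∈ nAC a, μC c) + (∑ c ∈ nDC e, μC c))
        = (∑ a, μA a * ∑ b ∈ nAB a, μB b) + (∑ b, μB b * ∑ e ∈ nBD b, μD e)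
          + (∑ a, μA a * ∑ c ∈ nAC a, μC c) + (∑ c, μC c * ∑ e ∈ nCD c, μD e) := by
      simp only [Finset.sum_add_distrib, Finset.sum_const, smul_eq_mul, rAD]
      rw [edge_sum_comm nAD nDA cAD (fun e => ∑ b ∈ nDB e, μB b),
        edge_sum_comm nAD nDA cAD (fun e => ∑ c ∈ nDC e, μC c)]
      simp only [rDA]
      rw [B_symm μD μB nDB nBD (fun e b => (cBD b e).symm), B_symm μD μC nDC nCD (fun e c => (cCD c e).symm)]
    have rhs : ∑ a ∈ (univ : Finset α), ∑ e ∈ nAD a,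
        ((∑ c ∈ nAC a, (nCB c ∩ nDB e).card) + (∑ b ∈ nAB a, (nBC b ∩ nDC e).card) + m)
        = (∑ a, ∑ c ∈ nAC a, ∑ e ∈ nAD a, (nCB c ∩ nDB e).card)
          + (∑ a, ∑ b ∈ nAB a, ∑ e ∈ nAD a, (nBC b ∩ nDC e).card) + m * m := by
      have hswap₁ : ∀ a : α, ∑ e ∈ nAD a, ∑ c ∈ nAC a, (nCB c ∩ nDB e).card
          = ∑ c ∈ nAC a, ∑ e ∈ nAD a, (nCB c ∩ nDB e).card := fun a => Finset.sum_comm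
      have hswap₂ : ∀ a : α, ∑ e ∈ nAD a, ∑ b ∈ nAB a, (nBC b ∩ nDC e).card
          = ∑ b ∈ nAB a, ∑ e ∈ nAD a, (nBC b ∩ nDC e).card := fun a => Finset.sum_comm
      simp only [Finset.sum_add_distrib, Finset.sum_const, smul_eq_mul, rAD, hswap₁, hswap₂]
      rw [← Finset.sum_mul, mA]
    rw [lhs, rhs] at hsum; exact hsum
  nlinarith [m₁, m₂, m₃]

/-- `B_XY ≤ h · p_X`: if every margin of `Y` is at most `h`, then `Σ_x μX x · Σ_{y ∈ nXY x} μY y ≤ h · Σ_x (μX x)²`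
(the inner sum has `#(nXY x) = μX x` terms, each `≤ h`). -/
theorem B_le {X Y : Type*} [Fintype X] (h : ℕ) (μX : X → ℕ) (μY : Y → ℕ) (nXY : X → Finset Y)
    (rXY : ∀ x, (nXY x).card = μX x) (hY : ∀ y, μY y ≤ h) :
    ∑ x, μX x * ∑ y ∈ nXY x, μY y ≤ h * ∑ x, μX x ^ 2 := by
  calc ∑ x, μX x * ∑ y ∈ nXY x, μY y ≤ ∑ x, μX x * (μX x * h) :=
        Finset.sum_le_sum (fun x _ => Nat.mul_le_mul_left _
          ((Finset.sum_le_sum (fun y _ => hY y)).trans (by rw [Finset.sum_const, smul_eq_mul, rXY])))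
    _ = h * ∑ x, μX x ^ 2 := by rw [Finset.mul_sum]; exact Finset.sum_congr rfl (fun x _ => by ring)

/-- `C_X ≤ h · p_X`: `Σ_x (μX x)³ ≤ h · Σ_x (μX x)²` when every margin is `≤ h`. -/
theorem C_le {X : Type*} [Fintype X] (h : ℕ) (μX : X → ℕ) (hX : ∀ x, μX x ≤ h) :
    ∑ x, μX x ^ 3 ≤ h * ∑ x, μX x ^ 2 := by
  rw [Finset.mul_sum]
  exact Finset.sum_le_sum (fun x _ => by
    calc μX x ^ 3 = μX x * μX x ^ 2 := by ring
      _ ≤ h * μX x ^ 2 := Nat.mul_le_mul_right _ (hX x))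

/-- **COROLLARY H** (FLATTF-w5n62g17 §9), arithmetic core. Feed it `triangleFree_box_inequality` (`hL`),
the six `B_le` and four `C_le` bounds summed (`hB : ΣB ≤ 6 h p`, `hC : ΣC ≤ 4 h p`, with `p` the common
value of `Σ_x (μX x)²` on the four coordinates in the triangle-free sector), and the `|S| = 4` class
equation of N7F §3.8 (a) in the integer form `m ΣN = m (2ΣB + ΣC − 2m²) − 9 p²` (triangle-free:
`Paw = F₅ = K₄ = 0`, `m s = −3 p`). Conclusion: `m³ + 18 p² ≤ 20 h m p`, and `18 m ≤ 100 h²` if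
`0 < m` — the heaviest margin of a triangle-free K-secant design is at least `√(0.18 m)`. -/
theorem heavy_margin_bound (m h p SB SC SN : ℕ) (hL : 2 * SB ≤ 2 * SN + 3 * m ^ 2)
    (hclass : (m : ℤ) * SN = m * (2 * SB + SC - 2 * m ^ 2) - 9 * p ^ 2)
    (hB : SB ≤ 6 * h * p) (hC : SC ≤ 4 * h * p) :
    m ^ 3 + 18 * p ^ 2 ≤ 20 * h * m * p ∧ (0 < m → 18 * m ≤ 100 * h ^ 2) := by
  have hm : (0 : ℤ) ≤ m := by positivity
  have hLz : 2 * (SB : ℤ) ≤ 2 * SN + 3 * m ^ 2 := by exact_mod_cast hL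
  have hBz : (SB : ℤ) ≤ 6 * h * p := by exact_mod_cast hB
  have hCz : (SC : ℤ) ≤ 4 * h * p := by exact_mod_cast hC
  have h1 : (m : ℤ) * (2 * SB) ≤ m * (2 * SN + 3 * m ^ 2) := mul_le_mul_of_nonneg_left hLz hm
  have h2 : (m : ℤ) * SB ≤ m * (6 * h * p) := mul_le_mul_of_nonneg_left hBz hm
  have h3 : (m : ℤ) * SC ≤ m * (4 * h * p) := mul_le_mul_of_nonneg_left hCz hm
  have main : (m : ℤ) ^ 3 + 18 * p ^ 2 ≤ 20 * h * m * p := by linarith [h1, h2, h3, hclass]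
  refine ⟨by exact_mod_cast main, fun hmpos => ?_⟩
  have key : (m : ℤ) ^ 2 * (100 * h ^ 2 - 18 * m)
      = (18 * p - 10 * h * m) ^ 2 + 18 * (20 * h * m * p - m ^ 3 - 18 * p ^ 2) := by ring
  have hnn : (0 : ℤ) ≤ m ^ 2 * (100 * h ^ 2 - 18 * m) := by
    rw [key]; have hsq := sq_nonneg (18 * (p : ℤ) - 10 * h * m); linarith
  by_contra hc
  have hc' : (100 * h ^ 2 : ℤ) < 18 * m := by exact_mod_cast Nat.lt_of_not_le hc
  have hpos : (0 : ℤ) < m ^ 2 := by positivity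
  have hneg : (m : ℤ) ^ 2 * (18 * m - 100 * h ^ 2) > 0 := mul_pos hpos (by linarith)
  have hsum : (m : ℤ) ^ 2 * (100 * h ^ 2 - 18 * m) + m ^ 2 * (18 * m - 100 * h ^ 2) = 0 := by ring
  linarith

end Design

end TriangleFreeBoxMargins

end Summit.Ventures.HSemireg
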